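import Summits.Ventures.YMGap.Thresholds.StarLemmaGArray
import HarnessLib

/-!
# Venture YMGap — track (c) «DS», brick B4b (ii): the SUPER-SOLUTION of Lemma G on the frozen star
# (hypotheses `hsol` and `hrowW` of Föllmer's comparison for the kernel on `⋆ ∖ {a}`)

HONEST FRAMING: venture file (cell `pub-ymgap`, PLAN R95/R96 K-row), strong-coupling LATTICE
bookkeeping; finite combinatorics of the torus star and real arithmetic, NO measure, nothing about the
continuum or the mass gap.

For a star plaquette `q` of `s` with star links `a ≠ b` and a boundary link `y ∈ q` off the star, the
vector `dvec c s y a b = 𝟙_y + c · kside c s a b` (`StarLemmaGArray`) satisfies, with the tree's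
Dobrushin coefficients `C(x, z) = c · tInfluence x z` of the torus Wilson specification (`c = β_W/4`):
* `dvec_superSolution` — `Σ_{z ∈ linkNbrT x} C(x,z) dvec z ≤ dvec x` for `x ∈ ⋆ ∖ {a}` (in fact
  equality: the column equation `StarColumn.col_superSolution`, after p3's adapter
  `sum_linkNbrT_tInfluence_mul`, (G2) «adjacent = directions differ» and (G3) «the star plaquette
  through a boundary link is unique»), `0 ≤ c ≤ 7/40`, side `≥ 3`;
* `rowSum_frozenStar_le` — `Σ_{z ∈ linkNbrT x, z ∈ ⋆ ∖ {a}} C(x,z) ≤ 6c` (`jointPlaq ≤ 1`, `|⋆| = 8`).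

References: cell files `GAUGE-STAR.md` §4 (ds-2), `B4-BLUEPRINT.md` §3 (ds-4); H. Föllmer, LNM 1362
(1988) Ch. I (2.8)–(2.10).
-/

noncomputable section

open MeasureTheory Function Finset
open Literature.Probability.LatticeModels
open Literature.Probability.LatticeModels.DobrushinMetric
open Literature.MathematicalPhysics.QuantumFieldTheory
open Literature.MathematicalPhysics.QuantumFieldTheory.Balaban1983to89.StrongCouplingTorusWindow
open Summit.Ventures.YMGap.DSWindow
open Summit.Ventures.YMGap.StarKernel
open Summit.Ventures.YMGap.StarColumn
open Summit.Ventures.YMGap.StarWindowGauge (gaugeR)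

namespace Summit.Ventures.YMGap.StarLemmaG

variable {L : ℕ} [NeZero L]

/-! ### The super-solution on the torus star (hypothesis `hsol` of the window comparison) -/

/-- On a star plaquette `q` with star links `a ≠ b`, a star link on `q` other than `a` is `b`.
[folklore] -/
theorem eq_of_mem_starPlaq (hL : 1 < L) {s : Site 4 L} {q : Plaquette 4 L} (hq : q ∈ starPlaqs s)
    {a b x : Edge 4 L} (ha : a ∈ vertexStar s) (haq : a ∈ plaqEdgesT q) (hb : b ∈ vertexStar s)
    (hbq : b ∈ plaqEdgesT q) (hab : a ≠ b) (hx : x ∈ vertexStar s) (hxq : x ∈ plaqEdgesT q)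
    (hxa : x ≠ a) : x = b := by
  obtain ⟨a0, b0, -, hf⟩ := filter_mem_vertexStar_plaqEdgesT hL hq
  have mem : ∀ {e : Edge 4 L}, e ∈ plaqEdgesT q → e ∈ vertexStar s → e = a0 ∨ e = b0 := by
    intro e he hes
    have h : e ∈ (plaqEdgesT q).filter (fun e => e ∈ vertexStar s) := mem_filter.2 ⟨he, hes⟩
    rw [hf] at h
    simpa using h
  rcases mem hxq hx with hx' | hx'
  · have ha' : a = b0 := (mem haq ha).resolve_left (fun h => hxa (hx'.trans h.symm))
    have hb' : b = a0 := (mem hbq hb).resolve_right (fun h => hab (ha'.trans h.symm))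
    exact hx'.trans hb'.symm
  · have ha' : a = a0 := (mem haq ha).resolve_right (fun h => hxa (hx'.trans h.symm))
    have hb' : b = b0 := (mem hbq hb).resolve_left (fun h => hab (ha'.trans h.symm))
    exact hx'.trans hb'.symm

/-- The star part of a `jointPlaq`-weighted sum in coordinates: for star links `a, x` (labels `α, ξ`)
and any `b` (label `β`), side `≥ 3`,
`Σ_{z ∈ ⋆ ∖ {x}} jointPlaq x z · kside c s a b z = Σ_{ζ ∈ colSet α ξ} Dpos c α β ζ`
((G2): `jointPlaq = [directions differ]` on the star). [folklore] -/
theorem sum_star_jointPlaq_kside (hL : 3 ≤ L) (c : ℝ) {s : Site 4 L} {a x : Edge 4 L}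
    (ha : a ∈ vertexStar s) (hx : x ∈ vertexStar s) (b : Edge 4 L) :
    ∑ z ∈ (vertexStar s).erase x, (jointPlaq x z : ℝ) * kside c s a b z =
      ∑ ζ ∈ colSet (label s a) (label s x), Dpos c (label s a) (label s b) ζ := by
  have hL1 : 1 < L := by omega
  -- `jointPlaq x z = [z.2 ≠ x.2]` on the star, `z ≠ x`
  have hj : ∀ z ∈ (vertexStar s).erase x, (jointPlaq x z : ℝ) * kside c s a b z =
      if z.2 ≠ x.2 then kside c s a b z else 0 := by
    intro z hz
    obtain ⟨hzx, hzs⟩ := mem_erase.1 hz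
    by_cases hdir : z.2 ≠ x.2
    · rw [if_pos hdir, jointPlaq_eq_one_of_vertexStar_of_snd_ne hL hx hzs (Ne.symm hdir), Nat.cast_one,
        one_mul]
    · rw [if_neg hdir]
      have hdir' : z.2 = x.2 := not_ne_iff.1 hdir
      rw [jointPlaq_eq_zero_of_vertexStar_of_snd_eq hL1 hx hzs (Ne.symm hzx) hdir'.symm, Nat.cast_zero,
        zero_mul]
  rw [sum_congr rfl hj]
  -- extend the sum to the whole star (the `x` term vanishes) and pass to coordinates
  have hxterm : (if x.2 ≠ x.2 then kside c s a b x else 0) = 0 := by simp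
  rw [sum_erase (vertexStar s) hxterm, sum_vertexStar_eq_sum_starLink hL1 s]
  simp only [starLink_snd]
  rw [colSet, sum_filter]
  refine sum_congr rfl fun ζ _ => ?_
  have hk : kside c s a b (starLink s ζ.1 ζ.2) =
      if ζ = label s a then 0 else Dpos c (label s a) (label s b) ζ := by
    unfold kside
    rw [label_starLink hL1]
    by_cases h : ζ = label s a
    · rw [if_pos h, if_pos (((label_eq_iff hL1 ha ζ).1 h.symm).symm)]
    · rw [if_neg h, if_neg (fun h' => h ((label_eq_iff hL1 ha ζ).2 h'.symm).symm)]
  rw [hk]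
  simp only [label_fst]
  by_cases h1 : ζ.1 ≠ x.2
  · by_cases h2 : ζ = label s a
    · rw [if_pos h1, if_pos h2, if_neg (fun h => h.1 h2)]
    · rw [if_pos h1, if_neg h2, if_pos ⟨h2, h1⟩]
  · rw [if_neg h1, if_neg (fun h => h1 h.2)]

/-- **Super-solution inequality (in fact equality) on the frozen star** `⋆ ∖ {a}`: for
`x ∈ ⋆ ∖ {a}`, `Σ_{z ∈ linkNbrT x} c · tInfluence x z · dvec z ≤ dvec x` — after the adapter
`sum_linkNbrT_tInfluence_mul`, (G2)/(G3) and coordinates this is `StarColumn.col_superSolution`.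
[folklore] -/
theorem dvec_superSolution (hL : 3 ≤ L) {c : ℝ} (h0 : 0 ≤ c) (h1 : c ≤ 7 / 40) {s : Site 4 L}
    {q : Plaquette 4 L} (hq : q ∈ starPlaqs s) {y : Edge 4 L} (hyq : y ∈ plaqEdgesT q)
    (hy : y ∉ vertexStar s) {a b : Edge 4 L} (ha : a ∈ vertexStar s) (haq : a ∈ plaqEdgesT q)
    (hb : b ∈ vertexStar s) (hbq : b ∈ plaqEdgesT q) (hab : a ≠ b) {x : Edge 4 L}
    (hx : x ∈ (vertexStar s).erase a) :
    ∑ z ∈ linkNbrT x, c * (tInfluence x z : ℝ) * dvec c s y a b z ≤ dvec c s y a b x := by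
  have hL1 : 1 < L := by omega
  obtain ⟨hxa, hxs⟩ := mem_erase.1 hx
  have hxy : x ≠ y := fun h => hy (h ▸ hxs)
  -- pull out `c` and use the adapter
  have hre : ∑ z ∈ linkNbrT x, c * (tInfluence x z : ℝ) * dvec c s y a b z =
      c * ∑ z ∈ univ.erase x, (jointPlaq x z : ℝ) * dvec c s y a b z := by
    rw [← sum_linkNbrT_tInfluence_mul hL1 x, mul_sum]
    exact sum_congr rfl fun z _ => by ring
  -- the `y` term: `jointPlaq x y = [x = b]`
  have hyx : y ∈ univ.erase x := mem_erase.2 ⟨hxy.symm, mem_univ _⟩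
  have hyterm : (jointPlaq x y : ℝ) * dvec c s y a b y = if x = b then 1 else 0 := by
    have hdy : dvec c s y a b y = 1 := by simp [dvec]
    rw [hdy, mul_one]
    by_cases hxq : x ∈ plaqEdgesT q
    · rw [if_pos (eq_of_mem_starPlaq hL1 hq ha haq hb hbq hab hxs hxq hxa),
        jointPlaq_eq_one_of_mem hL hxy hxq hyq, Nat.cast_one]
    · have hxb : x ≠ b := fun h => hxq (h ▸ hbq)
      rw [if_neg hxb, jointPlaq_eq_zero_of_not_mem_starPlaq hL hq hyq hy hxs hxq, Nat.cast_zero]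
  -- the rest: only star links `z ≠ x` contribute, with weight `c · kside`
  have hrest : ∑ z ∈ (univ.erase x).erase y, (jointPlaq x z : ℝ) * dvec c s y a b z =
      c * ∑ ζ ∈ colSet (label s a) (label s x), Dpos c (label s a) (label s b) ζ := by
    rw [← sum_star_jointPlaq_kside hL c ha hxs b, mul_sum]
    symm
    calc ∑ z ∈ (vertexStar s).erase x, c * ((jointPlaq x z : ℝ) * kside c s a b z)
        = ∑ z ∈ (vertexStar s).erase x, (jointPlaq x z : ℝ) * dvec c s y a b z :=
          sum_congr rfl fun z hz => by
            obtain ⟨-, hzs⟩ := mem_erase.1 hz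
            have hzy : z ≠ y := fun h => hy (h ▸ hzs)
            simp only [dvec, if_neg hzy, if_pos hzs]
            ring
      _ = ∑ z ∈ (univ.erase x).erase y, (jointPlaq x z : ℝ) * dvec c s y a b z := by
          refine sum_subset (fun z hz => ?_) (fun z hz hz' => ?_)
          · obtain ⟨hzx, hzs⟩ := mem_erase.1 hz
            exact mem_erase.2 ⟨fun h => hy (h ▸ hzs), mem_erase.2 ⟨hzx, mem_univ _⟩⟩
          · obtain ⟨hzy, hz2⟩ := mem_erase.1 hz
            have hzs : z ∉ vertexStar s := fun h => hz' (mem_erase.2 ⟨(mem_erase.1 hz2).1, h⟩)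
            simp only [dvec, if_neg hzy, if_neg hzs, mul_zero]
  rw [hre, ← add_sum_erase _ _ hyx, hyterm, hrest]
  -- in coordinates this is the column equation
  have hdx : dvec c s y a b x = c * Dpos c (label s a) (label s b) (label s x) := by
    simp only [dvec, if_neg hxy, if_pos hxs, kside, if_neg hxa]
  have hdir : (label s a).1 ≠ (label s b).1 := by
    simpa only [label_fst] using snd_ne_of_mem_starPlaq hL1 ha hb hab haq hbq
  have hxa' : label s x ≠ label s a := fun h => hxa (eq_of_label_eq hL1 hxs ha h)
  have hif : (if x = b then (1 : ℝ) else 0) = if label s x = label s b then 1 else 0 := by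
    by_cases h : x = b
    · rw [if_pos h, if_pos (by rw [h])]
    · rw [if_neg h, if_neg (fun h' => h (eq_of_label_eq hL1 hxs hb h'))]
  rw [hdx, hif, ← col_superSolution h0 h1 hdir hxa']

/-- **Restricted row sums on the frozen star** (hypothesis `hrowW`): for `x ∈ ⋆ ∖ {a}`,
`Σ_{z ∈ linkNbrT x, z ∈ ⋆ ∖ {a}} c · tInfluence x z ≤ 6c` (`jointPlaq ≤ 1` and `|⋆ ∖ {a, x}| = 6`).
[folklore] -/
theorem rowSum_frozenStar_le (hL : 3 ≤ L) {c : ℝ} (h0 : 0 ≤ c) {s : Site 4 L} {a x : Edge 4 L}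
    (ha : a ∈ vertexStar s) (hx : x ∈ (vertexStar s).erase a) :
    ∑ z ∈ linkNbrT x, (if z ∈ (vertexStar s).erase a then c * (tInfluence x z : ℝ) else 0) ≤
      6 * c := by
  have hL1 : 1 < L := by omega
  have hre : ∑ z ∈ linkNbrT x, (if z ∈ (vertexStar s).erase a then c * (tInfluence x z : ℝ) else 0) =
      c * ∑ z ∈ univ.erase x,
        (jointPlaq x z : ℝ) * (if z ∈ (vertexStar s).erase a then 1 else 0) := by
    rw [← sum_linkNbrT_tInfluence_mul hL1 x, mul_sum]
    refine sum_congr rfl fun z _ => ?_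
    split_ifs <;> ring
  have hsum : ∑ z ∈ univ.erase x, (jointPlaq x z : ℝ) * (if z ∈ (vertexStar s).erase a then 1 else 0) =
      ∑ z ∈ ((vertexStar s).erase a).erase x, (jointPlaq x z : ℝ) := by
    symm
    calc ∑ z ∈ ((vertexStar s).erase a).erase x, (jointPlaq x z : ℝ)
        = ∑ z ∈ ((vertexStar s).erase a).erase x,
            (jointPlaq x z : ℝ) * (if z ∈ (vertexStar s).erase a then 1 else 0) :=
          sum_congr rfl fun z hz => by rw [if_pos (mem_erase.1 hz).2, mul_one]
      _ = _ := by
          refine sum_subset (fun z hz => mem_erase.2 ⟨(mem_erase.1 hz).1, mem_univ _⟩)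
            (fun z hz hz' => ?_)
          have h : z ∉ (vertexStar s).erase a := fun h => hz' (mem_erase.2 ⟨(mem_erase.1 hz).1, h⟩)
          rw [if_neg h, mul_zero]
  have hle : ∑ z ∈ ((vertexStar s).erase a).erase x, (jointPlaq x z : ℝ) ≤
      ∑ z ∈ ((vertexStar s).erase a).erase x, (1 : ℝ) :=
    sum_le_sum fun z hz => by exact_mod_cast jointPlaq_le_one hL (Ne.symm (mem_erase.1 hz).1)
  have hcard : (((vertexStar s).erase a).erase x).card = 6 := by
    rw [card_erase_of_mem hx, card_erase_of_mem ha, card_vertexStar hL1 s]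
  rw [hre, hsum]
  calc c * ∑ z ∈ ((vertexStar s).erase a).erase x, (jointPlaq x z : ℝ)
      ≤ c * ∑ z ∈ ((vertexStar s).erase a).erase x, (1 : ℝ) := mul_le_mul_of_nonneg_left hle h0
    _ = 6 * c := by rw [sum_const, hcard]; simp [mul_comm]

end Summit.Ventures.YMGap.StarLemmaG

end
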